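import Mathlib
import HarnessLib

/-!
# Laguerre's theorem on the zeros of a polynomial in a circular region (centre-of-mass form)

Topic: Analysis / Complex (`Literature/Analysis/Complex/`).

A **circular region** of the plane is a closed disc, the closed exterior of a disc, or a closed
half-plane; uniformly, the set
`K(α, β, γ) = {w ∈ ℂ : α|w|² + 2 Re(β̄ w) + γ ≤ 0}` with `α, γ ∈ ℝ`, `β ∈ ℂ`
(`α > 0` disc, `α < 0` exterior, `α = 0` half-plane). For a polynomial `p` of degree `n ≥ 1`
and a point `z` with `p(z) ≠ 0` the **centre of mass of the zeros with respect to `z`**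
([Prasolov2004, Thm 1.1.6]; Henrici's point `z + n h₀`, `h₀` the Newton correction) is

  `ζ_z = z − n p(z)/p'(z)`,   the preimage of the mean `(1/n) Σ_k 1/(z − w_k) = p'(z)/(n p(z))`

of the zeros `w_k` under the inversion `w ↦ 1/(z − w)` (`ζ_z = ∞` if `p'(z) = 0`).

**Laguerre's theorem** ([Henrici1974, §6.5 Thm 6.5b]; [Prasolov2004, §1.1.3, Lemma 1.1.11]):
*if all zeros of `p` lie in a circular region `K` and `z ∉ K`, then `ζ_z ∈ K`* (the inversion
maps `K` onto a disc, discs are convex, and the mean of points of a disc lies in the disc).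
Equivalently (Henrici's formulation with the polar derivative `D_ζ p = n p − (X − ζ) p'`): for
`ζ ∉ K` every zero of `D_ζ p` lies in `K`.

Main statements (all over `ℂ`, zeros = members of `p.roots`, `n = p.natDegree`):

* `circQuad α β γ w = α |w|² + 2 Re(β̄ w) + γ` (definition) and its three instances
  `circQuad_disc`, `circQuad_exterior`, `circQuad_halfPlane`;
* `circQuad_inv_mul_normSq`, `circQuad_complete_square`, `discr_eq` — the inversion
  `w = z − 1/u` turns `K` into the disc `|Q u − conj(α z + β)|² ≤ |β|² − α γ`, `Q = circQuad(z) > 0`;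
* `normSq_mean_le` — the mean of finitely many points of such a disc lies in it;
* `laguerre` — THE THEOREM in the uniform form: zeros in `K(α,β,γ)`, `circQuad(z) > 0` ⟹
  (`p'(z) = 0 → α ≤ 0`, i.e. `ζ_z = ∞` only for unbounded `K`) and
  (`p'(z) ≠ 0 → ζ_z = z − n p(z)/p'(z) ∈ K`);
* `laguerre_disc` (zeros in `|w − c| ≤ r`, `|z − c| > r` ⟹ `p'(z) ≠ 0` and `|ζ_z − c| ≤ r`),
  `laguerre_exterior` (zeros in `|w − c| ≥ r`, `|z − c| < r`, `p'(z) ≠ 0` ⟹ `|ζ_z − c| ≥ r`),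
  `laguerre_halfPlane` (zeros in `Re(ē(w − c)) ≤ 0`, `Re(ē(z − c)) > 0` ⟹ `p'(z) ≠ 0` and
  `Re(ē(ζ_z − c)) ≤ 0`; the non-vanishing of `p'` is the Gauss–Lucas half-plane lemma
  `derivative_eval_ne_zero_of_re_le`);
* `polarDerivative_root_mem_disc` — Henrici's form 6.5b for a disc: zeros in `|w − c| ≤ r`,
  `|ζ − c| > r`, `n p(w) = (w − ζ) p'(w)` ⟹ `|w − c| ≤ r`.

Not formalised: boundary points `z ∈ ∂K` (Henrici allows `c` in the closure of the complement,
with the degenerate case `p = a(X − c)ⁿ`), Cor 6.5c, Grace's theorem, Laguerre's Theorems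
1.1.7/1.1.8 of [Prasolov2004] on `X(z) = z − 2(n−1) p'/p''`. The Newton-step corollary
Thm 6.5d is the separate file `LaguerreNewtonDisc`.
-/

noncomputable section

open Polynomial Complex ComplexConjugate

namespace Literature.Analysis.Complex.LaguerreTheorem

/-! ## Circular regions as sublevel sets of a real quadratic -/

/-- The circular quadratic `circQuad α β γ w = α |w|² + 2 Re(β̄ w) + γ`; the circular region is
`{w | circQuad α β γ w ≤ 0}` (disc for `α > 0`, exterior of a disc for `α < 0`, half-plane for
`α = 0`, `β ≠ 0`). [cite: Prasolov2004, §1.1.4] -/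
def circQuad (α : ℝ) (β : ℂ) (γ : ℝ) (w : ℂ) : ℝ := α * normSq w + 2 * (conj β * w).re + γ

/-- Unfolding of the circle/half-plane quadratic form `circQuad`. [folklore] -/
private theorem circQuad_eq (α : ℝ) (β : ℂ) (γ : ℝ) (w : ℂ) :
    circQuad α β γ w = α * ‖w‖ ^ 2 + 2 * (conj β * w).re + γ := by
  rw [circQuad, normSq_eq_norm_sq]

/-- The closed disc `|w − c| ≤ r` is `K(1, −c, |c|² − r²)`. [folklore] -/
private theorem circQuad_disc (c : ℂ) (r : ℝ) (w : ℂ) :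
    circQuad 1 (-c) (normSq c - r ^ 2) w = normSq (w - c) - r ^ 2 := by
  simp only [circQuad, normSq_apply, mul_re, sub_re, sub_im, map_neg, neg_re, neg_im, conj_re,
    conj_im]
  ring

/-- The closed exterior `|w − c| ≥ r` is `K(−1, c, r² − |c|²)`. [folklore] -/
private theorem circQuad_exterior (c : ℂ) (r : ℝ) (w : ℂ) :
    circQuad (-1) c (r ^ 2 - normSq c) w = r ^ 2 - normSq (w - c) := by
  simp only [circQuad, normSq_apply, mul_re, sub_re, sub_im, conj_re, conj_im]
  ring

/-- The closed half-plane `Re(ē (w − c)) ≤ 0` is `K(0, e, −2 Re(ē c))`. [folklore] -/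
private theorem circQuad_halfPlane (e c : ℂ) (w : ℂ) :
    circQuad 0 e (-(2 * (conj e * c).re)) w = 2 * (conj e * (w - c)).re := by
  simp only [circQuad, mul_re, sub_re, sub_im, conj_re, conj_im]
  ring

/-! ## The inversion `w = z − 1/u` -/

/-- Under `w = z − u⁻¹` (`u ≠ 0`) the circular quadratic becomes, after multiplication by
`|u|²`, the quadratic `Q |u|² − 2 Re((α z + β) u) + α` with `Q = circQuad α β γ z`.
[cite: Prasolov2004, §1.1.3] -/
theorem circQuad_inv_mul_normSq (α : ℝ) (β : ℂ) (γ : ℝ) (z : ℂ) {u : ℂ} (hu : u ≠ 0) :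
    circQuad α β γ (z - u⁻¹) * normSq u =
      circQuad α β γ z * normSq u - 2 * (((α : ℂ) * z + β) * u).re + α := by
  have hN : u.re * u.re + u.im * u.im ≠ 0 := by
    rw [← normSq_apply]; exact (normSq_pos.mpr hu).ne'
  have hN' : u.re ^ 2 + u.im ^ 2 ≠ 0 := by
    rw [sq, sq]; exact hN
  simp only [circQuad, normSq_apply, mul_re, mul_im, sub_re, sub_im, inv_re, inv_im, add_re,
    add_im, ofReal_re, ofReal_im, conj_re, conj_im]
  field_simp
  ring

/-- Completing the square: `Q (Q |u|² − 2 Re(ℓ u) + α) = |Q u − conj ℓ|² − (|ℓ|² − α Q)`.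
[folklore] -/
private theorem circQuad_complete_square (Q α : ℝ) (ℓ u : ℂ) :
    Q * (Q * normSq u - 2 * (ℓ * u).re + α) =
      normSq ((Q : ℂ) * u - conj ℓ) - (normSq ℓ - α * Q) := by
  simp only [normSq_apply, mul_re, mul_im, sub_re, sub_im, ofReal_re, ofReal_im, conj_re,
    conj_im]
  ring

/-- The discriminant is invariant: `|α z + β|² − α · circQuad α β γ z = |β|² − α γ`.
[folklore] -/
private theorem discr_eq (α : ℝ) (β : ℂ) (γ : ℝ) (z : ℂ) :
    normSq ((α : ℂ) * z + β) - α * circQuad α β γ z = normSq β - α * γ := by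
  simp only [circQuad, normSq_apply, mul_re, mul_im, add_re, add_im, ofReal_re, ofReal_im,
    conj_re, conj_im]
  ring

/-- The dictionary: for `Q = circQuad α β γ z > 0` and `u ≠ 0`, the point `z − u⁻¹` lies in the
circular region iff `u` lies in the closed disc `|Q u − conj(α z + β)|² ≤ |β|² − α γ`.
[cite: Prasolov2004, §1.1.3] -/
theorem circQuad_inv_nonpos_iff {α : ℝ} {β : ℂ} {γ : ℝ} {z : ℂ} (hz : 0 < circQuad α β γ z)
    {u : ℂ} (hu : u ≠ 0) :
    circQuad α β γ (z - u⁻¹) ≤ 0 ↔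
      normSq ((circQuad α β γ z : ℂ) * u - conj ((α : ℂ) * z + β)) ≤ normSq β - α * γ := by
  have hN : 0 < normSq u := normSq_pos.mpr hu
  rw [← discr_eq α β γ z, ← sub_nonpos (b := normSq _ - _), ← circQuad_complete_square,
    ← circQuad_inv_mul_normSq α β γ z hu]
  constructor
  · intro h
    exact mul_nonpos_of_nonneg_of_nonpos hz.le (mul_nonpos_of_nonpos_of_nonneg h hN.le)
  · intro h
    have h' : circQuad α β γ (z - u⁻¹) * normSq u ≤ 0 := by
      by_contra hc
      push Not at hc
      exact absurd h (not_le.mpr (mul_pos hz hc))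
    by_contra hc
    push Not at hc
    exact absurd h' (not_le.mpr (mul_pos hc hN))

/-! ## Means of points of a disc -/

/-- The mean of finitely many points of the closed disc `|Q u − c|² ≤ Δ` lies in that disc.
[folklore] -/
private theorem normSq_mean_le {U : Multiset ℂ} (hU : U ≠ 0) {Q Δ : ℝ} {c : ℂ}
    (h : ∀ u ∈ U, normSq ((Q : ℂ) * u - c) ≤ Δ) :
    normSq ((Q : ℂ) * (U.sum / (Multiset.card U : ℂ)) - c) ≤ Δ := by
  have hm : 0 < Multiset.card U := Multiset.card_pos.mpr hU
  have hmC : (Multiset.card U : ℂ) ≠ 0 := by exact_mod_cast hm.ne'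
  obtain ⟨u₀, hu₀, hmax⟩ := U.toFinset.exists_max_image (fun u => ‖(Q : ℂ) * u - c‖)
    ⟨_, Multiset.mem_toFinset.mpr (Multiset.exists_mem_of_ne_zero hU).choose_spec⟩
  set M := ‖(Q : ℂ) * u₀ - c‖ with hM
  have hle : ∀ u ∈ U, ‖(Q : ℂ) * u - c‖ ≤ M := fun u hu =>
    hmax u (Multiset.mem_toFinset.mpr hu)
  -- the deviation of the mean is the mean of the deviations
  have hsum : (Q : ℂ) * (U.sum / (Multiset.card U : ℂ)) - c =
      (U.map fun u => (Q : ℂ) * u - c).sum / (Multiset.card U : ℂ) := by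
    rw [Multiset.sum_map_sub, Multiset.sum_map_mul_left, Multiset.map_id', Multiset.map_const',
      Multiset.sum_replicate, nsmul_eq_mul]
    field_simp
  have hnorm : ‖(Q : ℂ) * (U.sum / (Multiset.card U : ℂ)) - c‖ ≤ M := by
    rw [hsum, norm_div, Complex.norm_natCast, div_le_iff₀ (by exact_mod_cast hm)]
    refine (norm_multiset_sum_le _).trans ?_
    rw [Multiset.map_map]
    have := Multiset.sum_le_card_nsmul (U.map fun u => ‖(Q : ℂ) * u - c‖) M
      (by
        intro x hx
        obtain ⟨u, hu, rfl⟩ := Multiset.mem_map.mp hx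
        exact hle u hu)
    rw [Multiset.card_map, nsmul_eq_mul] at this
    rw [Function.comp_def, mul_comm]
    exact this
  calc normSq ((Q : ℂ) * (U.sum / (Multiset.card U : ℂ)) - c)
      = ‖(Q : ℂ) * (U.sum / (Multiset.card U : ℂ)) - c‖ ^ 2 := normSq_eq_norm_sq _
    _ ≤ M ^ 2 := pow_le_pow_left₀ (norm_nonneg _) hnorm 2
    _ = normSq ((Q : ℂ) * u₀ - c) := (normSq_eq_norm_sq _).symm
    _ ≤ Δ := h u₀ (Multiset.mem_toFinset.mp hu₀)

/-! ## Laguerre's theorem -/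

variable {p : ℂ[X]}

/-- `Σ_{w ∈ roots p} (z − w)⁻¹ = p'(z)/p(z)` for `p(z) ≠ 0` (Mathlib's logarithmic derivative).
[folklore] -/
private theorem sum_roots_inv_sub_eq {z : ℂ} (h0 : p.eval z ≠ 0) :
    (p.roots.map fun w => (z - w)⁻¹).sum = p.derivative.eval z / p.eval z := by
  rw [(IsAlgClosed.splits p).eval_derivative_div_eval_of_ne_zero h0]
  exact congrArg _ (Multiset.map_congr rfl fun w _ => (one_div _).symm)

/-- A point outside the circular region containing the zeros is not a zero. [folklore] -/
private theorem eval_ne_zero_of_circQuad_pos {α : ℝ} {β : ℂ} {γ : ℝ} (hn : 0 < p.natDegree)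
    (hK : ∀ w ∈ p.roots, circQuad α β γ w ≤ 0) {z : ℂ} (hz : 0 < circQuad α β γ z) :
    p.eval z ≠ 0 := by
  intro h
  have hz' := hK z (mem_roots'.mpr ⟨ne_zero_of_natDegree_gt hn, h⟩)
  linarith

/-- **Laguerre's theorem (uniform centre-of-mass form).** Let `deg p = n ≥ 1`, let all zeros of
`p` lie in the circular region `K = {w | α|w|² + 2Re(β̄w) + γ ≤ 0}` and let `z ∉ K`
(`circQuad α β γ z > 0`). Then (i) if `p'(z) = 0` the region is unbounded (`α ≤ 0`; the centre of
mass is `∞ ∈ K`), and (ii) if `p'(z) ≠ 0` the centre of mass `ζ_z = z − n p(z)/p'(z)` lies in `K`.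
[cite: Henrici1974, §6.5 Thm 6.5b; Prasolov2004, §1.1.3 Thm 1.1.6, Lemma 1.1.11] -/
theorem laguerre {α : ℝ} {β : ℂ} {γ : ℝ} (hn : 0 < p.natDegree)
    (hK : ∀ w ∈ p.roots, circQuad α β γ w ≤ 0) {z : ℂ} (hz : 0 < circQuad α β γ z) :
    (p.derivative.eval z = 0 → α ≤ 0) ∧
    (p.derivative.eval z ≠ 0 →
      circQuad α β γ (z - p.natDegree * p.eval z / p.derivative.eval z) ≤ 0) := by
  have h0 : p.eval z ≠ 0 := eval_ne_zero_of_circQuad_pos hn hK hz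
  set U : Multiset ℂ := p.roots.map fun w => (z - w)⁻¹ with hU
  have hcard : Multiset.card U = p.natDegree := by
    rw [hU, Multiset.card_map, ← (IsAlgClosed.splits p).natDegree_eq_card_roots]
  have hUne : U ≠ 0 := by
    intro h; rw [h, Multiset.card_zero] at hcard; omega
  have hUsum : U.sum = p.derivative.eval z / p.eval z := sum_roots_inv_sub_eq h0
  -- every inverted zero lies in the image disc
  have hdisc : ∀ u ∈ U, normSq ((circQuad α β γ z : ℂ) * u - conj ((α : ℂ) * z + β)) ≤
      normSq β - α * γ := by
    intro u hu
    obtain ⟨w, hw, rfl⟩ := Multiset.mem_map.mp hu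
    have hzw : z - w ≠ 0 := by
      intro h; rw [sub_eq_zero] at h; rw [h] at hz; linarith [hK w hw]
    have hu0 : (z - w)⁻¹ ≠ 0 := inv_ne_zero hzw
    rw [← circQuad_inv_nonpos_iff hz hu0, inv_inv, sub_sub_cancel]
    exact hK w hw
  have hmean := normSq_mean_le hUne hdisc
  rw [hcard, hUsum] at hmean
  have hnC : (p.natDegree : ℂ) ≠ 0 := by exact_mod_cast hn.ne'
  constructor
  · intro h1
    rw [h1, zero_div, zero_div, mul_zero, zero_sub, normSq_neg, normSq_conj,
      ← discr_eq α β γ z] at hmean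
    have : α * circQuad α β γ z ≤ 0 := by linarith
    by_contra hα
    push Not at hα
    exact absurd this (not_le.mpr (mul_pos hα hz))
  · intro h1
    have hu0 : p.derivative.eval z / p.eval z / (p.natDegree : ℂ) ≠ 0 :=
      div_ne_zero (div_ne_zero h1 h0) hnC
    have key := (circQuad_inv_nonpos_iff hz hu0).mpr hmean
    have hrw : z - (p.derivative.eval z / p.eval z / (p.natDegree : ℂ))⁻¹ =
        z - p.natDegree * p.eval z / p.derivative.eval z := by
      congr 1
      field_simp
    rwa [hrw] at key

/-- **Laguerre's theorem for a disc.** If all zeros of `p` (`deg p ≥ 1`) satisfy `|w − c| ≤ r`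
and `|z − c| > r`, then `p'(z) ≠ 0` and the centre of mass `z − n p(z)/p'(z)` lies in the disc.
[cite: Henrici1974, §6.5 Thm 6.5b; Prasolov2004, §1.1.3 Lemma 1.1.11] -/
theorem laguerre_disc (hn : 0 < p.natDegree) {c : ℂ} {r : ℝ}
    (hK : ∀ w ∈ p.roots, ‖w - c‖ ≤ r) {z : ℂ} (hz : r < ‖z - c‖) :
    p.derivative.eval z ≠ 0 ∧ ‖(z - p.natDegree * p.eval z / p.derivative.eval z) - c‖ ≤ r := by
  -- a zero exists, so `0 ≤ r`
  have hne : p.roots ≠ 0 := by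
    intro h
    have := (IsAlgClosed.splits p).natDegree_eq_card_roots
    rw [h, Multiset.card_zero] at this; omega
  obtain ⟨w₀, hw₀⟩ := Multiset.exists_mem_of_ne_zero hne
  have hr : 0 ≤ r := (norm_nonneg _).trans (hK w₀ hw₀)
  have hK' : ∀ w ∈ p.roots, circQuad 1 (-c) (normSq c - r ^ 2) w ≤ 0 := by
    intro w hw
    rw [circQuad_disc, sub_nonpos, normSq_eq_norm_sq]
    exact pow_le_pow_left₀ (norm_nonneg _) (hK w hw) 2
  have hz' : 0 < circQuad 1 (-c) (normSq c - r ^ 2) z := by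
    rw [circQuad_disc, sub_pos, normSq_eq_norm_sq]
    exact pow_lt_pow_left₀ hz hr two_ne_zero
  obtain ⟨h₁, h₂⟩ := laguerre hn hK' hz'
  have hd : p.derivative.eval z ≠ 0 := fun h => absurd (h₁ h) (by norm_num)
  refine ⟨hd, ?_⟩
  have := h₂ hd
  rw [circQuad_disc, sub_nonpos, normSq_eq_norm_sq] at this
  exact (pow_le_pow_iff_left₀ (norm_nonneg _) hr two_ne_zero).mp this

/-- **Laguerre's theorem for the exterior of a disc.** If all zeros of `p` (`deg p ≥ 1`) satisfy
`|w − c| ≥ r`, `|z − c| < r` and `p'(z) ≠ 0`, then `|ζ_z − c| ≥ r` for the centre of mass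
`ζ_z = z − n p(z)/p'(z)` (if `p'(z) = 0` the centre of mass is `∞`, also in the region).
[cite: Henrici1974, §6.5 Thm 6.5b; Prasolov2004, §1.1.3 Lemma 1.1.11] -/
theorem laguerre_exterior (hn : 0 < p.natDegree) {c : ℂ} {r : ℝ}
    (hK : ∀ w ∈ p.roots, r ≤ ‖w - c‖) {z : ℂ} (hz : ‖z - c‖ < r)
    (h1 : p.derivative.eval z ≠ 0) :
    r ≤ ‖(z - p.natDegree * p.eval z / p.derivative.eval z) - c‖ := by
  have hr : 0 < r := (norm_nonneg _).trans_lt hz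
  have hK' : ∀ w ∈ p.roots, circQuad (-1) c (r ^ 2 - normSq c) w ≤ 0 := by
    intro w hw
    rw [circQuad_exterior, sub_nonpos, normSq_eq_norm_sq]
    exact pow_le_pow_left₀ hr.le (hK w hw) 2
  have hz' : 0 < circQuad (-1) c (r ^ 2 - normSq c) z := by
    rw [circQuad_exterior, sub_pos, normSq_eq_norm_sq]
    exact pow_lt_pow_left₀ hz (norm_nonneg _) two_ne_zero
  have := (laguerre hn hK' hz').2 h1
  rw [circQuad_exterior, sub_nonpos, normSq_eq_norm_sq] at this
  exact (pow_le_pow_iff_left₀ hr.le (norm_nonneg _) two_ne_zero).mp this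

/-- The Gauss–Lucas half-plane lemma: if all zeros satisfy `Re(ē(w − c)) ≤ 0` and
`Re(ē(z − c)) > 0` then `p'(z) ≠ 0` (indeed `Re(e · p'(z)/p(z)) > 0`). [folklore] -/
private theorem derivative_eval_ne_zero_of_re_le (hn : 0 < p.natDegree) {e c : ℂ}
    (hK : ∀ w ∈ p.roots, (conj e * (w - c)).re ≤ 0) {z : ℂ} (hz : 0 < (conj e * (z - c)).re) :
    p.derivative.eval z ≠ 0 := by
  have hK' : ∀ w ∈ p.roots, circQuad 0 e (-(2 * (conj e * c).re)) w ≤ 0 := by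
    intro w hw; rw [circQuad_halfPlane]; linarith [hK w hw]
  have hz' : 0 < circQuad 0 e (-(2 * (conj e * c).re)) z := by
    rw [circQuad_halfPlane]; linarith
  have h0 : p.eval z ≠ 0 := eval_ne_zero_of_circQuad_pos hn hK' hz'
  have hne : p.roots ≠ 0 := by
    intro h
    have := (IsAlgClosed.splits p).natDegree_eq_card_roots
    rw [h, Multiset.card_zero] at this; omega
  -- each inverted zero has positive real part against `e`
  have hpos : ∀ w ∈ p.roots, 0 < (e * (z - w)⁻¹).re := by
    intro w hw
    have h1 : 0 < (conj e * (z - w)).re := by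
      have : conj e * (z - w) = conj e * (z - c) - conj e * (w - c) := by ring
      rw [this, sub_re]; linarith [hK w hw]
    have hzw : z - w ≠ 0 := by
      intro h; rw [h, mul_zero, zero_re] at h1; exact lt_irrefl 0 h1
    have h2 : e * (z - w)⁻¹ = conj (conj e * (z - w)) * ((normSq (z - w))⁻¹ : ℝ) := by
      rw [inv_def, map_mul, conj_conj, ← mul_assoc]
    rw [h2, re_mul_ofReal, conj_re]
    exact mul_pos h1 (inv_pos.mpr (normSq_pos.mpr hzw))
  have hsum : 0 < (e * (p.derivative.eval z / p.eval z)).re := by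
    rw [← sum_roots_inv_sub_eq h0, ← Multiset.sum_map_mul_left, ← coe_reAddGroupHom,
      map_multiset_sum, Multiset.map_map]
    have hlt := Multiset.sum_lt_sum_of_nonempty (s := p.roots) (f := fun _ : ℂ => (0 : ℝ))
      (g := (fun x : ℂ => reAddGroupHom x) ∘ fun w => e * (z - w)⁻¹) hne
      (fun w hw => by simpa using hpos w hw)
    simpa using hlt
  intro h
  rw [h, zero_div, mul_zero, zero_re] at hsum
  exact lt_irrefl 0 hsum

/-- **Laguerre's theorem for a half-plane.** If all zeros of `p` (`deg p ≥ 1`) satisfy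
`Re(ē(w − c)) ≤ 0` and `Re(ē(z − c)) > 0`, then `p'(z) ≠ 0` and the centre of mass
`ζ_z = z − n p(z)/p'(z)` satisfies `Re(ē(ζ_z − c)) ≤ 0`.
[cite: Henrici1974, §6.5 Thm 6.5b; Prasolov2004, §1.1.3 Lemma 1.1.11] -/
theorem laguerre_halfPlane (hn : 0 < p.natDegree) {e c : ℂ}
    (hK : ∀ w ∈ p.roots, (conj e * (w - c)).re ≤ 0) {z : ℂ} (hz : 0 < (conj e * (z - c)).re) :
    p.derivative.eval z ≠ 0 ∧
      (conj e * ((z - p.natDegree * p.eval z / p.derivative.eval z) - c)).re ≤ 0 := by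
  have hK' : ∀ w ∈ p.roots, circQuad 0 e (-(2 * (conj e * c).re)) w ≤ 0 := by
    intro w hw; rw [circQuad_halfPlane]; linarith [hK w hw]
  have hz' : 0 < circQuad 0 e (-(2 * (conj e * c).re)) z := by
    rw [circQuad_halfPlane]; linarith
  have hd := derivative_eval_ne_zero_of_re_le hn hK hz
  refine ⟨hd, ?_⟩
  have := (laguerre hn hK' hz').2 hd
  rw [circQuad_halfPlane] at this
  linarith

/-- **Henrici's form (Thm 6.5b) for a disc: zeros of the polar derivative.** If all zeros of `p`
(`deg p = n ≥ 1`) lie in `|w − c| ≤ r` and `|ζ − c| > r`, then every zero `w` of the polar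
derivative `D_ζ p = n p − (X − ζ) p'`, i.e. every `w` with `n p(w) = (w − ζ) p'(w)`, lies in
`|w − c| ≤ r`. [cite: Henrici1974, §6.5 Thm 6.5b; Prasolov2004, §1.1.4 Lemma 1.1.11] -/
theorem polarDerivative_root_mem_disc (hn : 0 < p.natDegree) {c : ℂ} {r : ℝ}
    (hK : ∀ w ∈ p.roots, ‖w - c‖ ≤ r) {ζ : ℂ} (hζ : r < ‖ζ - c‖) {w : ℂ}
    (hw : (p.natDegree : ℂ) * p.eval w = (w - ζ) * p.derivative.eval w) : ‖w - c‖ ≤ r := by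
  by_contra hwc
  push Not at hwc
  obtain ⟨hd, hmem⟩ := laguerre_disc hn hK hwc
  have hL : w - p.natDegree * p.eval w / p.derivative.eval w = ζ := by
    rw [hw, mul_div_cancel_right₀ _ hd, sub_sub_cancel]
  rw [hL] at hmem
  exact absurd hmem (not_le.mpr hζ)

end Literature.Analysis.Complex.LaguerreTheorem

end
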